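import Literature.MathematicalPhysics.QuantumLattice.HubbardTTPrimeThermalStatesEntropyDensity
import Literature.MathematicalPhysics.QuantumLattice.InfVolFermionStateMixture
import Literature.InformationTheory.Entropy.VonNeumannEntropyMixingBound
import HarnessLib

/-!
# Phase coexistence at `T > 0` in the 2D `t–t'` Hubbard model: the COMPONENTS of a thermal grand-canonical state are
# variational equilibrium states, satisfy the Griffiths brackets, and the density jump of coexisting phases is bounded
# by certified pressures

Topic `Literature/MathematicalPhysics/QuantumLattice`; the `T > 0` companion of `HubbardTTPrimePhaseCoexistenceExclusion.lean` (`T = 0`),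
resting on the thermodynamic-limit variational principle (`HubbardTTPrimeThermalStatesEntropyDensity.lean`: box entropies of every
translation-invariant state are `≤ ℓ²(P + βu) + o(ℓ²)`, those of a thermal grand-canonical state are `≥ ℓ²(P + βu)`) and on the
mixing-entropy bound `S(λρ + (1−λ)σ) ≤ λS(ρ) + (1−λ)S(σ) + log 2` (`VonNeumannEntropyMixingBound.lean`, from weak monotonicity).
Setting (`β ≥ 0`, `U ≥ 0`, `P = gcPressureTT'Zeeman β t t' U μ h`, `u_x(ω) = e_Φ(ω) − μρ(ω) − h m(ω)`): a thermal grand-canonical state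
`ω` (torus limit of the Gibbs states of `H_L − μN − hM` along `Ls → ∞`) which is a non-trivial mixture `ω = λω₁ + (1−λ)ω₂`
(`InfVolFermionState.mix`, `0 < λ < 1`) of translation-invariant states — PHASE COEXISTENCE. PROVED:

* §1 `rdm_mix`, `vonNeumannEntropy_rdm_mix_le` — `S((λω₁+(1−λ)ω₂)_B) ≤ λS(ω₁,B) + (1−λ)S(ω₂,B) + log 2` for every region `B`.
* §2 **COMPONENTS ARE VARIATIONAL EQUILIBRIUM STATES** (`sq_mul_le_vonNeumannEntropy_rdm_of_mix_left`): for every `ℓ ≥ 1`,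
  `λ·ℓ²(P + βu(ω₁)) ≤ λ·S(ω₁,[0,ℓ)²) + (1−λ)(β(8|t|+16|t'|)ℓ + 2log(ℓ²+1)) + log 2`; hence `S(ω₁,[0,ℓ)²)/ℓ² → P + βu(ω₁)`
  (`tendsto_vonNeumannEntropy_rdm_div_sq_of_mix_left`; the same for `ω₂` by `mix_symm`-free restatement `…_right`).
* §3 **GRIFFITHS BRACKETS FOR THE COMPONENTS** (`gcPressureTT'Zeeman_sub_le_of_mix_left`): for every `(β₁;x₁)` with `β₁, U₁ ≥ 0`,
  `P(β;x) − [β₁u_{x₁}(ω₁) − βu_x(ω₁)] ≤ P(β₁;x₁)` — the joint temperature × coupling tangent plane (R59) holds for EACH PHASE, not only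
  for the mixture; coordinate instances `mul_density_mul_sub_le_…_of_mix_left` (`βρ(ω₁)(μ₁−μ) ≤ P(μ₁) − P(μ)`) etc.
* §4 **THE DENSITY JUMP OF COEXISTING PHASES IS BOUNDED BY THE PRESSURE CURVATURE**
  (`abs_density_sub_density_le_of_mix`, `β > 0`, `δ > 0`): `|ρ(ω₁) − ρ(ω₂)| ≤ (P(μ+δ) + P(μ−δ) − 2P(μ))/(βδ)`; certified form
  `…_of_certificates`: `W ≤ P(μ)`, `P(μ±δ) ≤ Q±` ⇒ `|ρ(ω₁) − ρ(ω₂)| ≤ (Q₊ + Q₋ − 2W)/(βδ)` — three grand-canonical pressure certificates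
  bound the density contrast of ANY two coexisting translation-invariant phases at `(β;t,t',U;μ,h)` (first-order transition /
  phase separation at `T > 0`: a competing-order word from pressures alone).

HONEST SCOPE: two-component convex decompositions into translation-invariant states of a thermal grand-canonical torus-limit
state (more components: group them); no statement about the existence of such decompositions, about periodic (stripe) components, or
about canonical states. Everything is PROVED; no definition, no named fact.

## Mathlib / tree search

REUSED: `IsTranslationInvariant.vonNeumannEntropy_rdm_halfOpenBox_le`, `….eventually_vonNeumannEntropy_rdm_div_sq_le`,
`IsTorusLimitOfMixture.sq_mul_le_vonNeumannEntropy_rdm_halfOpenBox_of_gcGibbs` (`HubbardTTPrimeThermalStatesEntropyDensity`);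
`vonNeumannEntropy_convexComb_two_le_add_log_two` (`VonNeumannEntropyMixingBound`); `mix`, `mix_expect`, `density_mix`, `meanEnergy_mix`,
`IsTranslationInvariant.mix` (`InfVolFermionState(Mixture)`); `rdm_apply`, `rdm_posSemidef`, `trace_rdm`, `IsTorusLimitOfMixture.isTranslationInvariant`.
`lean search 'coexist|of_mix_left|density jump'`: nothing (2026-08-27).

## References

* R. B. Israel, *Convexity in the Theory of Lattice Gases* (1979), Thm. I.2.4, §III (tangent functionals; phase transitions as
  non-differentiability of the pressure). [cite: Israel1979, Thm. I.2.4]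
* H. Araki, H. Moriya, Rev. Math. Phys. 15 (2003) 93, Thm. 3.8, §10–§12 (variational principle; equilibrium states of lattice
  fermions form a face). [cite: ArakiMoriya2003, Theorem 3.8 and §10]
* R. B. Griffiths, J. Math. Phys. 5 (1964) 1215. [cite: Griffiths1964]
* M. A. Nielsen, I. L. Chuang (2010), Theorem 11.10 eq. (11.88). [cite: NielsenChuang2010, Theorem 11.10 eq. (11.88) p.518]
-/

noncomputable section

open scoped ComplexOrder BigOperators
open Finset Literature.InformationTheory.Entropy

namespace Literature.MathematicalPhysics.QuantumLattice

open Matrix HubbardWave0 Literature.Probability.LatticeModels ThermodynamicLimit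
open Literature.Computability.QuantumComplexity (IsDensity)
open _root_.Filter
open scoped _root_.Topology

namespace InfVolFermionState

/-! ### §1 Density matrices and entropies of mixtures -/

/-- The local density matrices of a mixture are the mixtures of the local density matrices. [cite: BratteliRobinsonI1987, §4.3.1] -/
theorem rdm_mix {d : ℕ} (s : ℝ) (hs₀ : 0 ≤ s) (hs₁ : s ≤ 1) (ω₁ ω₂ : InfVolFermionState d) (Λ : Finset (Site d)) :
    (mix s hs₀ hs₁ ω₁ ω₂).rdm Λ = ((s : ℝ) : ℂ) • ω₁.rdm Λ + (((1 - s : ℝ)) : ℂ) • ω₂.rdm Λ := by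
  ext a b
  simp only [rdm_apply, mix_expect, Matrix.add_apply, Matrix.smul_apply, smul_eq_mul]

/-- **Mixing costs at most `log 2` of entropy per region**: `S((sω₁ + (1−s)ω₂)_Λ) ≤ s·S(ω₁,Λ) + (1−s)·S(ω₂,Λ) + log 2`.
[cite: NielsenChuang2010, Theorem 11.10 eq. (11.88) p.518] -/
theorem vonNeumannEntropy_rdm_mix_le {d : ℕ} (s : ℝ) (hs₀ : 0 ≤ s) (hs₁ : s ≤ 1) (ω₁ ω₂ : InfVolFermionState d)
    (Λ : Finset (Site d)) :
    vonNeumannEntropy ((mix s hs₀ hs₁ ω₁ ω₂).rdm Λ) ≤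
      s * vonNeumannEntropy (ω₁.rdm Λ) + (1 - s) * vonNeumannEntropy (ω₂.rdm Λ) + Real.log 2 := by
  have h₁ : IsDensity (ω₁.rdm Λ) := ⟨ω₁.rdm_posSemidef Λ, ω₁.trace_rdm Λ⟩
  have h₂ : IsDensity (ω₂.rdm Λ) := ⟨ω₂.rdm_posSemidef Λ, ω₂.trace_rdm Λ⟩
  have h := vonNeumannEntropy_convexComb_two_le_add_log_two (t := 1 - s) (by linarith) (by linarith) h₁ h₂
  rw [rdm_mix]
  have e : (((1 - (1 - s) : ℝ)) : ℂ) • ω₁.rdm Λ + (((1 - s : ℝ)) : ℂ) • ω₂.rdm Λ =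
      ((s : ℝ) : ℂ) • ω₁.rdm Λ + (((1 - s : ℝ)) : ℂ) • ω₂.rdm Λ := by
    rw [sub_sub_cancel]
  rw [e] at h
  have e2 : (1 - (1 - s)) = s := by ring
  rw [e2] at h
  exact h

/-- The mixture taken the other way round: `λω₁ + (1−λ)ω₂ = (1−λ)ω₂ + λω₁`. [cite: BratteliRobinsonI1987, §4.3.1] -/
theorem mix_comm {d : ℕ} (s : ℝ) (hs₀ : 0 ≤ s) (hs₁ : s ≤ 1) (ω₁ ω₂ : InfVolFermionState d) :
    InfVolFermionState.mix s hs₀ hs₁ ω₁ ω₂ =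
      InfVolFermionState.mix (1 - s) (by linarith) (by linarith) ω₂ ω₁ := by
  refine InfVolFermionState.ext fun Λ => LinearMap.ext fun A => ?_
  rw [mix_expect, mix_expect, sub_sub_cancel]
  ring

/-! ### §2 The components of a thermal grand-canonical state are variational equilibrium states -/

variable {β : ℝ} (hβ : 0 ≤ β) (t t' : ℝ) {U : ℝ} (hU : 0 ≤ U) (μ hz : ℝ)
  {ω₁ ω₂ : InfVolFermionState 2} {Ls : ℕ → ℕ}
include hβ hU

/-- **The first phase carries the equilibrium entropy density, finite-box form.** If the mixture `λω₁ + (1−λ)ω₂` (`0 < λ ≤ 1`,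
`ω₁, ω₂` translation invariant) is a thermal grand-canonical state at `(β; x)`, then for every `ℓ ≥ 1`:
`λ·ℓ²·(P + βu(ω₁)) ≤ λ·S(ω₁,[0,ℓ)²) + (1−λ)·(β(8|t|+16|t'|)ℓ + 2 log(ℓ²+1)) + log 2`.
[cite: ArakiMoriya2003, Theorem 3.8 and §10] [cite: Israel1979, Thm. I.2.4] -/
theorem IsTorusLimitOfMixture.sq_mul_le_vonNeumannEntropy_rdm_of_mix_left
    (_h₁ : ω₁.IsTranslationInvariant) (h₂ : ω₂.IsTranslationInvariant) {lam : ℝ} (hl0 : 0 < lam) (hl1 : lam ≤ 1)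
    (hω : (InfVolFermionState.mix lam hl0.le hl1 ω₁ ω₂).IsTorusLimitOfMixture sourcedGibbsCount (gcGibbsWeightTT' β t t' U μ hz)
      (gcGibbsVectorTT' t t' U μ hz) Ls)
    (hLs : Tendsto Ls atTop atTop) {ℓ : ℕ} (hℓ : 1 ≤ ℓ) :
    lam * ((ℓ : ℝ) ^ 2 * (gcPressureTT'Zeeman β t t' U μ hz +
        β * (ω₁.meanEnergy (hubbardTTPrimeFermionInteraction t t' U) 1 - μ * ω₁.density -
          hz * ((ω₁.expect ({0} : Finset (Site 2)) (nAt 0 (mem_singleton_self 0) 0)).re -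
            (ω₁.expect ({0} : Finset (Site 2)) (nAt 0 (mem_singleton_self 0) 1)).re)))) ≤
      lam * vonNeumannEntropy (ω₁.rdm (halfOpenBox 2 ℓ)) +
        (1 - lam) * (β * ((8 * |t| + 16 * |t'|) * ℓ) + 2 * Real.log ((ℓ : ℝ) ^ 2 + 1)) + Real.log 2 := by
  set ω := InfVolFermionState.mix lam hl0.le hl1 ω₁ ω₂ with hωdef
  -- the mixture's entropy from below (thermal), the second component's from above (variational principle), mixing bound
  have hlow := hω.sq_mul_le_vonNeumannEntropy_rdm_halfOpenBox_of_gcGibbs hβ t t' hU μ hz hLs hℓ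
  have hup₂ := h₂.vonNeumannEntropy_rdm_halfOpenBox_le hβ t t' hU μ hz hℓ
  have hmixS := vonNeumannEntropy_rdm_mix_le lam hl0.le hl1 ω₁ ω₂ (halfOpenBox 2 ℓ)
  -- the `K`-energy of the mixture is the mixture of the `K`-energies
  have hu : ω.meanEnergy (hubbardTTPrimeFermionInteraction t t' U) 1 - μ * ω.density -
      hz * ((ω.expect ({0} : Finset (Site 2)) (nAt 0 (mem_singleton_self 0) 0)).re -
        (ω.expect ({0} : Finset (Site 2)) (nAt 0 (mem_singleton_self 0) 1)).re) =
      lam * (ω₁.meanEnergy (hubbardTTPrimeFermionInteraction t t' U) 1 - μ * ω₁.density -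
          hz * ((ω₁.expect ({0} : Finset (Site 2)) (nAt 0 (mem_singleton_self 0) 0)).re -
            (ω₁.expect ({0} : Finset (Site 2)) (nAt 0 (mem_singleton_self 0) 1)).re)) +
        (1 - lam) * (ω₂.meanEnergy (hubbardTTPrimeFermionInteraction t t' U) 1 - μ * ω₂.density -
          hz * ((ω₂.expect ({0} : Finset (Site 2)) (nAt 0 (mem_singleton_self 0) 0)).re -
            (ω₂.expect ({0} : Finset (Site 2)) (nAt 0 (mem_singleton_self 0) 1)).re)) := by
    rw [hωdef, meanEnergy_mix, density_mix, mix_expect, mix_expect]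
    simp only [Complex.add_re, Complex.re_ofReal_mul]
    ring
  rw [hu] at hlow
  rw [← hωdef] at hmixS
  have hl1' : 0 ≤ 1 - lam := by linarith
  have hβℓ : 0 ≤ (ℓ : ℝ) ^ 2 := by positivity
  nlinarith [hlow, hup₂, hmixS, mul_le_mul_of_nonneg_left hup₂ hl1', hl0, hl1']

/-- **The first phase's box entropies per site, two-sided**: for every `ℓ ≥ 1`,
`P + βu(ω₁) − [(1−λ)(β(8|t|+16|t'|)+4)/ℓ + log 2/ℓ²]/λ ≤ S(ω₁,[0,ℓ)²)/ℓ² ≤ P + βu(ω₁) + (β(8|t|+16|t'|)+4)/ℓ`.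
[cite: ArakiMoriya2003, Theorem 3.8 and §10] -/
theorem IsTorusLimitOfMixture.vonNeumannEntropy_rdm_div_sq_mem_Icc_of_mix_left
    (h₁ : ω₁.IsTranslationInvariant) (h₂ : ω₂.IsTranslationInvariant) {lam : ℝ} (hl0 : 0 < lam) (hl1 : lam ≤ 1)
    (hω : (InfVolFermionState.mix lam hl0.le hl1 ω₁ ω₂).IsTorusLimitOfMixture sourcedGibbsCount (gcGibbsWeightTT' β t t' U μ hz)
      (gcGibbsVectorTT' t t' U μ hz) Ls)
    (hLs : Tendsto Ls atTop atTop) {ℓ : ℕ} (hℓ : 1 ≤ ℓ) :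
    vonNeumannEntropy (ω₁.rdm (halfOpenBox 2 ℓ)) / (ℓ : ℝ) ^ 2 ∈ Set.Icc
      (gcPressureTT'Zeeman β t t' U μ hz +
        β * (ω₁.meanEnergy (hubbardTTPrimeFermionInteraction t t' U) 1 - μ * ω₁.density -
          hz * ((ω₁.expect ({0} : Finset (Site 2)) (nAt 0 (mem_singleton_self 0) 0)).re -
            (ω₁.expect ({0} : Finset (Site 2)) (nAt 0 (mem_singleton_self 0) 1)).re)) -
        ((1 - lam) * (β * (8 * |t| + 16 * |t'|) + 4) / ℓ + Real.log 2 / (ℓ : ℝ) ^ 2) / lam)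
      (gcPressureTT'Zeeman β t t' U μ hz +
        β * (ω₁.meanEnergy (hubbardTTPrimeFermionInteraction t t' U) 1 - μ * ω₁.density -
          hz * ((ω₁.expect ({0} : Finset (Site 2)) (nAt 0 (mem_singleton_self 0) 0)).re -
            (ω₁.expect ({0} : Finset (Site 2)) (nAt 0 (mem_singleton_self 0) 1)).re)) +
        (β * (8 * |t| + 16 * |t'|) + 4) / ℓ) := by
  refine ⟨?_, h₁.vonNeumannEntropy_rdm_halfOpenBox_div_sq_le hβ t t' hU μ hz hℓ⟩
  have h := hω.sq_mul_le_vonNeumannEntropy_rdm_of_mix_left hβ t t' hU μ hz h₁ h₂ hl0 hl1 hLs hℓ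
  have hℓpos : (0 : ℝ) < ℓ := by exact_mod_cast hℓ
  have hℓ2 : (0 : ℝ) < (ℓ : ℝ) ^ 2 := by positivity
  -- `log(ℓ²+1) ≤ 2ℓ`
  have hlog : Real.log ((ℓ : ℝ) ^ 2 + 1) ≤ 2 * ℓ := by
    have hℓ' : (1 : ℝ) ≤ ℓ := by exact_mod_cast hℓ
    have e1 : (ℓ : ℝ) ^ 2 + 1 ≤ ((ℓ : ℝ) + 1) ^ 2 := by nlinarith
    have e3 : Real.log (((ℓ : ℝ) + 1) ^ 2) = 2 * Real.log ((ℓ : ℝ) + 1) := by rw [Real.log_pow]; push_cast; ring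
    have e4 : Real.log ((ℓ : ℝ) + 1) ≤ (ℓ : ℝ) + 1 - 1 := Real.log_le_sub_one_of_pos (by positivity)
    linarith [Real.log_le_log (by positivity : (0:ℝ) < (ℓ : ℝ) ^ 2 + 1) e1]
  set s₁ := vonNeumannEntropy (ω₁.rdm (halfOpenBox 2 ℓ)) with hs₁
  set A := gcPressureTT'Zeeman β t t' U μ hz +
        β * (ω₁.meanEnergy (hubbardTTPrimeFermionInteraction t t' U) 1 - μ * ω₁.density -
          hz * ((ω₁.expect ({0} : Finset (Site 2)) (nAt 0 (mem_singleton_self 0) 0)).re -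
            (ω₁.expect ({0} : Finset (Site 2)) (nAt 0 (mem_singleton_self 0) 1)).re)) with hA
  set c := β * (8 * |t| + 16 * |t'|) + 4 with hc
  -- from `h`: `lam ℓ² A ≤ lam s₁ + (1−lam)(β(8|t|+16|t'|)ℓ + 2log(ℓ²+1)) + log 2 ≤ lam s₁ + (1−lam) c ℓ + log 2`
  have hl1' : 0 ≤ 1 - lam := by linarith
  have h' : lam * ((ℓ : ℝ) ^ 2 * A) ≤ lam * s₁ + (1 - lam) * (c * ℓ) + Real.log 2 := by
    have : β * ((8 * |t| + 16 * |t'|) * ℓ) + 2 * Real.log ((ℓ : ℝ) ^ 2 + 1) ≤ c * ℓ := by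
      rw [hc]; nlinarith [hlog, hβ]
    nlinarith [h, mul_le_mul_of_nonneg_left this hl1']
  -- divide by `lam ℓ²`
  rw [sub_le_iff_le_add, ← sub_le_iff_le_add']
  rw [show A - s₁ / (ℓ : ℝ) ^ 2 = (lam * ((ℓ : ℝ) ^ 2 * A) - lam * s₁) / (lam * (ℓ : ℝ) ^ 2) by
    field_simp]
  rw [show ((1 - lam) * c / ℓ + Real.log 2 / (ℓ : ℝ) ^ 2) / lam =
      ((1 - lam) * (c * ℓ) + Real.log 2) / (lam * (ℓ : ℝ) ^ 2) by
    field_simp]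
  exact div_le_div_of_nonneg_right (by linarith) (by positivity)

/-- **THE FIRST PHASE IS A VARIATIONAL EQUILIBRIUM STATE**: its entropy density exists and equals `P + βu(ω₁)`,
`S(ω₁,[0,ℓ)²)/ℓ² → P + βu(ω₁)`. [cite: ArakiMoriya2003, Theorem 3.8 and §10] -/
theorem IsTorusLimitOfMixture.tendsto_vonNeumannEntropy_rdm_div_sq_of_mix_left
    (h₁ : ω₁.IsTranslationInvariant) (h₂ : ω₂.IsTranslationInvariant) {lam : ℝ} (hl0 : 0 < lam) (hl1 : lam ≤ 1)
    (hω : (InfVolFermionState.mix lam hl0.le hl1 ω₁ ω₂).IsTorusLimitOfMixture sourcedGibbsCount (gcGibbsWeightTT' β t t' U μ hz)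
      (gcGibbsVectorTT' t t' U μ hz) Ls)
    (hLs : Tendsto Ls atTop atTop) :
    Tendsto (fun ℓ : ℕ => vonNeumannEntropy (ω₁.rdm (halfOpenBox 2 ℓ)) / (ℓ : ℝ) ^ 2) atTop
      (𝓝 (gcPressureTT'Zeeman β t t' U μ hz +
        β * (ω₁.meanEnergy (hubbardTTPrimeFermionInteraction t t' U) 1 - μ * ω₁.density -
          hz * ((ω₁.expect ({0} : Finset (Site 2)) (nAt 0 (mem_singleton_self 0) 0)).re -
            (ω₁.expect ({0} : Finset (Site 2)) (nAt 0 (mem_singleton_self 0) 1)).re)))) := by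
  set A := gcPressureTT'Zeeman β t t' U μ hz +
        β * (ω₁.meanEnergy (hubbardTTPrimeFermionInteraction t t' U) 1 - μ * ω₁.density -
          hz * ((ω₁.expect ({0} : Finset (Site 2)) (nAt 0 (mem_singleton_self 0) 0)).re -
            (ω₁.expect ({0} : Finset (Site 2)) (nAt 0 (mem_singleton_self 0) 1)).re)) with hA
  set c := β * (8 * |t| + 16 * |t'|) + 4 with hc
  have hlo : Tendsto (fun ℓ : ℕ => A - ((1 - lam) * c / (ℓ : ℝ) + Real.log 2 / (ℓ : ℝ) ^ 2) / lam) atTop (𝓝 A) := by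
    have h1 : Tendsto (fun ℓ : ℕ => (1 - lam) * c / (ℓ : ℝ)) atTop (𝓝 0) := tendsto_const_div_atTop_nhds_zero_nat _
    have h2 : Tendsto (fun ℓ : ℕ => Real.log 2 / (ℓ : ℝ) ^ 2) atTop (𝓝 0) := by
      have h2' : Tendsto (fun ℓ : ℕ => ((ℓ : ℝ) ^ 2)⁻¹) atTop (𝓝 0) := by
        have := (tendsto_pow_atTop (n := 2) (α := ℝ) two_ne_zero).comp tendsto_natCast_atTop_atTop
        exact this.inv_tendsto_atTop
      have := h2'.const_mul (Real.log 2)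
      simpa [div_eq_mul_inv] using this
    have h3 := ((h1.add h2).div_const lam).const_sub A
    simpa using h3
  have hhi : Tendsto (fun ℓ : ℕ => A + c / (ℓ : ℝ)) atTop (𝓝 A) := by
    have := (tendsto_const_div_atTop_nhds_zero_nat c).const_add A
    rwa [add_zero] at this
  refine tendsto_of_tendsto_of_tendsto_of_le_of_le' hlo hhi ?_ ?_
  · filter_upwards [eventually_ge_atTop 1] with ℓ hℓ
    exact (hω.vonNeumannEntropy_rdm_div_sq_mem_Icc_of_mix_left hβ t t' hU μ hz h₁ h₂ hl0 hl1 hLs hℓ).1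
  · filter_upwards [eventually_ge_atTop 1] with ℓ hℓ
    exact (hω.vonNeumannEntropy_rdm_div_sq_mem_Icc_of_mix_left hβ t t' hU μ hz h₁ h₂ hl0 hl1 hLs hℓ).2

/-! ### §3 The Griffiths brackets hold for each phase -/

/-- **THE JOINT TEMPERATURE × COUPLING TANGENT PLANE FOR A PHASE.** If `λω₁ + (1−λ)ω₂` (`0 < λ ≤ 1`, both translation invariant) is
a thermal grand-canonical state at `(β; t,t',U; μ,h)`, then for every `β₁ ≥ 0`, `t₁, t'₁`, `U₁ ≥ 0`, `μ₁, h₁`: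
`P(β;x) − [β₁·u_{x₁}(ω₁) − β·u_x(ω₁)] ≤ P(β₁;x₁)` — the tangent inequality of the mixture (R59) holds for the COMPONENT `ω₁`
(upper half of the variational principle at `(β₁;x₁)` against the equilibrium entropy density of `ω₁` at `(β;x)`).
[cite: Israel1979, Thm. I.2.4] [cite: Griffiths1964] -/
theorem IsTorusLimitOfMixture.gcPressureTT'Zeeman_sub_le_of_mix_left
    (h₁ : ω₁.IsTranslationInvariant) (h₂ : ω₂.IsTranslationInvariant) {lam : ℝ} (hl0 : 0 < lam) (hl1 : lam ≤ 1)
    (hω : (InfVolFermionState.mix lam hl0.le hl1 ω₁ ω₂).IsTorusLimitOfMixture sourcedGibbsCount (gcGibbsWeightTT' β t t' U μ hz)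
      (gcGibbsVectorTT' t t' U μ hz) Ls)
    (hLs : Tendsto Ls atTop atTop) {β₁ : ℝ} (hβ₁ : 0 ≤ β₁) (t₁ t'₁ : ℝ) {U₁ : ℝ} (hU₁ : 0 ≤ U₁) (μ₁ h₁' : ℝ) :
    gcPressureTT'Zeeman β t t' U μ hz -
        (β₁ * (ω₁.meanEnergy (hubbardTTPrimeFermionInteraction t₁ t'₁ U₁) 1 - μ₁ * ω₁.density -
            h₁' * ((ω₁.expect ({0} : Finset (Site 2)) (nAt 0 (mem_singleton_self 0) 0)).re -
              (ω₁.expect ({0} : Finset (Site 2)) (nAt 0 (mem_singleton_self 0) 1)).re)) -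
          β * (ω₁.meanEnergy (hubbardTTPrimeFermionInteraction t t' U) 1 - μ * ω₁.density -
            hz * ((ω₁.expect ({0} : Finset (Site 2)) (nAt 0 (mem_singleton_self 0) 0)).re -
              (ω₁.expect ({0} : Finset (Site 2)) (nAt 0 (mem_singleton_self 0) 1)).re))) ≤
      gcPressureTT'Zeeman β₁ t₁ t'₁ U₁ μ₁ h₁' := by
  -- the entropy density of `ω₁` is `P(β;x) + βu_x(ω₁)`; the variational principle at `(β₁;x₁)` caps it by `P(β₁;x₁) + β₁u_{x₁}(ω₁)`
  have hlim := hω.tendsto_vonNeumannEntropy_rdm_div_sq_of_mix_left hβ t t' hU μ hz h₁ h₂ hl0 hl1 hLs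
  by_contra hcon
  have hgap : 0 < gcPressureTT'Zeeman β t t' U μ hz -
      (β₁ * (ω₁.meanEnergy (hubbardTTPrimeFermionInteraction t₁ t'₁ U₁) 1 - μ₁ * ω₁.density -
          h₁' * ((ω₁.expect ({0} : Finset (Site 2)) (nAt 0 (mem_singleton_self 0) 0)).re -
            (ω₁.expect ({0} : Finset (Site 2)) (nAt 0 (mem_singleton_self 0) 1)).re)) -
        β * (ω₁.meanEnergy (hubbardTTPrimeFermionInteraction t t' U) 1 - μ * ω₁.density -
          hz * ((ω₁.expect ({0} : Finset (Site 2)) (nAt 0 (mem_singleton_self 0) 0)).re -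
            (ω₁.expect ({0} : Finset (Site 2)) (nAt 0 (mem_singleton_self 0) 1)).re))) -
      gcPressureTT'Zeeman β₁ t₁ t'₁ U₁ μ₁ h₁' := by linarith [lt_of_not_ge hcon]
  set ε := (gcPressureTT'Zeeman β t t' U μ hz -
      (β₁ * (ω₁.meanEnergy (hubbardTTPrimeFermionInteraction t₁ t'₁ U₁) 1 - μ₁ * ω₁.density -
          h₁' * ((ω₁.expect ({0} : Finset (Site 2)) (nAt 0 (mem_singleton_self 0) 0)).re -
            (ω₁.expect ({0} : Finset (Site 2)) (nAt 0 (mem_singleton_self 0) 1)).re)) -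
        β * (ω₁.meanEnergy (hubbardTTPrimeFermionInteraction t t' U) 1 - μ * ω₁.density -
          hz * ((ω₁.expect ({0} : Finset (Site 2)) (nAt 0 (mem_singleton_self 0) 0)).re -
            (ω₁.expect ({0} : Finset (Site 2)) (nAt 0 (mem_singleton_self 0) 1)).re))) -
      gcPressureTT'Zeeman β₁ t₁ t'₁ U₁ μ₁ h₁') / 2 with hε
  have hεpos : 0 < ε := by rw [hε]; linarith
  have hup := h₁.eventually_vonNeumannEntropy_rdm_div_sq_le hβ₁ t₁ t'₁ hU₁ μ₁ h₁' hεpos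
  have hlow := (tendsto_order.1 hlim).1 _ (sub_lt_self _ hεpos)
  obtain ⟨ℓ, hℓup, hℓlow⟩ := (hup.and hlow).exists
  linarith

/-- **Griffiths bracket for a phase, density direction**: `βρ(ω₁)(μ₁ − μ) ≤ P(μ₁) − P(μ)`. [cite: Griffiths1964] -/
theorem IsTorusLimitOfMixture.mul_density_mul_sub_le_gcPressureTT'Zeeman_sub_of_mix_left
    (h₁ : ω₁.IsTranslationInvariant) (h₂ : ω₂.IsTranslationInvariant) {lam : ℝ} (hl0 : 0 < lam) (hl1 : lam ≤ 1)
    (hω : (InfVolFermionState.mix lam hl0.le hl1 ω₁ ω₂).IsTorusLimitOfMixture sourcedGibbsCount (gcGibbsWeightTT' β t t' U μ hz)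
      (gcGibbsVectorTT' t t' U μ hz) Ls)
    (hLs : Tendsto Ls atTop atTop) (μ₁ : ℝ) :
    β * ω₁.density * (μ₁ - μ) ≤ gcPressureTT'Zeeman β t t' U μ₁ hz - gcPressureTT'Zeeman β t t' U μ hz := by
  have h := hω.gcPressureTT'Zeeman_sub_le_of_mix_left hβ t t' hU μ hz h₁ h₂ hl0 hl1 hLs hβ t t' hU μ₁ hz
  nlinarith [h]

/-! ### §4 The density jump of coexisting phases -/

/-- **THE DENSITY JUMP OF TWO COEXISTING PHASES IS BOUNDED BY THE PRESSURE CURVATURE** (`β > 0`, `δ > 0`, `0 < λ < 1`):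
`|ρ(ω₁) − ρ(ω₂)| ≤ (P(μ+δ) + P(μ−δ) − 2P(μ))/(βδ)` — both phases satisfy the density brackets at `μ`, so both densities lie in
`[(P(μ) − P(μ−δ))/(βδ), (P(μ+δ) − P(μ))/(βδ)]`. [cite: Israel1979, Thm. I.2.4] [cite: Griffiths1964] -/
theorem IsTorusLimitOfMixture.abs_density_sub_density_le_of_mix (hβ' : 0 < β)
    (h₁ : ω₁.IsTranslationInvariant) (h₂ : ω₂.IsTranslationInvariant) {lam : ℝ} (hl0 : 0 < lam) (hl1 : lam < 1)
    (hω : (InfVolFermionState.mix lam hl0.le hl1.le ω₁ ω₂).IsTorusLimitOfMixture sourcedGibbsCount (gcGibbsWeightTT' β t t' U μ hz)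
      (gcGibbsVectorTT' t t' U μ hz) Ls)
    (hLs : Tendsto Ls atTop atTop) {δ : ℝ} (hδ : 0 < δ) :
    |ω₁.density - ω₂.density| ≤
      (gcPressureTT'Zeeman β t t' U (μ + δ) hz + gcPressureTT'Zeeman β t t' U (μ - δ) hz -
        2 * gcPressureTT'Zeeman β t t' U μ hz) / (β * δ) := by
  -- brackets for `ω₁`
  have a₁ := hω.mul_density_mul_sub_le_gcPressureTT'Zeeman_sub_of_mix_left hβ t t' hU μ hz h₁ h₂ hl0 hl1.le hLs (μ + δ)
  have b₁ := hω.mul_density_mul_sub_le_gcPressureTT'Zeeman_sub_of_mix_left hβ t t' hU μ hz h₁ h₂ hl0 hl1.le hLs (μ - δ)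
  -- brackets for `ω₂` (swap the roles)
  have hω' : (InfVolFermionState.mix (1 - lam) (by linarith) (by linarith) ω₂ ω₁).IsTorusLimitOfMixture sourcedGibbsCount
      (gcGibbsWeightTT' β t t' U μ hz) (gcGibbsVectorTT' t t' U μ hz) Ls := by
    rw [← mix_comm]; exact hω
  have a₂ := hω'.mul_density_mul_sub_le_gcPressureTT'Zeeman_sub_of_mix_left hβ t t' hU μ hz h₂ h₁ (by linarith) (by linarith)
    hLs (μ + δ)
  have b₂ := hω'.mul_density_mul_sub_le_gcPressureTT'Zeeman_sub_of_mix_left hβ t t' hU μ hz h₂ h₁ (by linarith) (by linarith)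
    hLs (μ - δ)
  have hβδ : 0 < β * δ := mul_pos hβ' hδ
  have key1 : (ω₁.density - ω₂.density) * (β * δ) ≤
      gcPressureTT'Zeeman β t t' U (μ + δ) hz + gcPressureTT'Zeeman β t t' U (μ - δ) hz -
        2 * gcPressureTT'Zeeman β t t' U μ hz := by nlinarith [a₁, b₂]
  have key2 : (ω₂.density - ω₁.density) * (β * δ) ≤
      gcPressureTT'Zeeman β t t' U (μ + δ) hz + gcPressureTT'Zeeman β t t' U (μ - δ) hz -
        2 * gcPressureTT'Zeeman β t t' U μ hz := by nlinarith [a₂, b₁]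
  rw [abs_sub_le_iff]
  exact ⟨(le_div_iff₀ hβδ).2 key1, (le_div_iff₀ hβδ).2 key2⟩

/-- **Certified form**: with a floor `W ≤ P(μ)` and ceilings `P(μ+δ) ≤ Q₊`, `P(μ−δ) ≤ Q₋` (three grand-canonical pressure
certificates), ANY two coexisting translation-invariant phases at `(β; t,t',U; μ,h)` have `|ρ(ω₁) − ρ(ω₂)| ≤ (Q₊ + Q₋ − 2W)/(βδ)`.
[cite: Israel1979, Thm. I.2.4] [cite: Griffiths1964] -/
theorem IsTorusLimitOfMixture.abs_density_sub_density_le_of_mix_of_certificates (hβ' : 0 < β)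
    (h₁ : ω₁.IsTranslationInvariant) (h₂ : ω₂.IsTranslationInvariant) {lam : ℝ} (hl0 : 0 < lam) (hl1 : lam < 1)
    (hω : (InfVolFermionState.mix lam hl0.le hl1.le ω₁ ω₂).IsTorusLimitOfMixture sourcedGibbsCount (gcGibbsWeightTT' β t t' U μ hz)
      (gcGibbsVectorTT' t t' U μ hz) Ls)
    (hLs : Tendsto Ls atTop atTop) {δ W Qp Qm : ℝ} (hδ : 0 < δ) (hW : W ≤ gcPressureTT'Zeeman β t t' U μ hz)
    (hQp : gcPressureTT'Zeeman β t t' U (μ + δ) hz ≤ Qp) (hQm : gcPressureTT'Zeeman β t t' U (μ - δ) hz ≤ Qm) :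
    |ω₁.density - ω₂.density| ≤ (Qp + Qm - 2 * W) / (β * δ) := by
  have h := hω.abs_density_sub_density_le_of_mix hβ t t' hU μ hz hβ' h₁ h₂ hl0 hl1 hLs hδ
  have hβδ : 0 < β * δ := mul_pos hβ' hδ
  exact h.trans (div_le_div_of_nonneg_right (by linarith) hβδ.le)

end InfVolFermionState

end Literature.MathematicalPhysics.QuantumLattice

end
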